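import Summits.BirchSwinnertonDyer.Rank1Residual.X12.HeegnerIndexRoute
import Literature.NumberTheory.EllipticCurves.Rank1Residual.X12CubeSumTransport
import Literature.NumberTheory.EllipticCurves.CongruentNumberCurveSupersingular
import Literature.NumberTheory.EllipticCurves.BSDAnalyticRankTunnellCMProofs
import Literature.NumberTheory.EllipticCurves.LiLiuTian2024.CongruentNumberFullBSD
import HarnessLib

/-!
# X12 inert-bad core, `e = 2` sub-cell at `p = 23`: three census pairs with `irr(23)` PROVED in the kernel (twist relation, partner minimality and good reduction discharged on the literal Cremona models)

HONEST FRAMING (cell `b2b-bsdres`, run/shared/lean/b2b/bsd-rank1-residual/, verbatim in every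
file): the goal of the cell is to DELETE the COMBINATION-SHAPED residual classes of the
Birch–Swinnerton-Dyer formula for ALL analytic-rank `≤ 1` elliptic curves over `ℚ` — "full BSD
formula for every rank `≤ 1` curve in class `C`" assembled STRICTLY from published theorems — so
that the rank-`≤ 1` remainder becomes exactly the CONSTRUCTION-SHAPED classes, which are TYPED
(missing-input `Prop`s), NOT attempted. This is not "finishing BSD". Harvest seat 1 (census owner
of class X12), generation 13: PER-PAIR RECORDS, theorems and model definitions only (no named fact,
no axiom); X12 REMAINS CONSTRUCTION-SHAPED; nothing is booked; no label and no census number moves.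

## Why these three pairs

Of the 72 inert-bad X12 core pairs (harvest-1 RECLASSIFY §GEN-7.2b / §GEN-13.1), the hyp seat's
irreducibility bit `irr(p)` ("no `ℚ`-rational `p`-isogeny") is certified by TWO engines (Cremona's
isogeny matrix; PARI `ellisomat`) for `p ≤ 19` and by ONE engine at `p ∈ {23, 29, 41}` — seven
pairs: `14283i1, 16928e1, 19044a1, 19044b1, 19044c1 @23`, `7569a1 @29`, `15129a1 @41`. For the
three of them that lie in the `e = 2` sub-cell — `14283i1`, `16928e1`, `19044c1` at `p = 23` — the
cell-topic theorem `X12.irr_of_hasCM_good_twist` (`HeegnerIndexRoute.lean`, p203236: a CM curve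
whose quadratic twist has a globally minimal model with GOOD reduction at `p ≥ 5` has irreducible
`E[p]`; Serre 1972 §1.11 Prop. 12 / §4.5, both PROVED in the tree, + twist invariance) makes
`irr(23)` a KERNEL THEOREM once its three hypotheses are discharged on the literal models:

| pair | Cremona minimal model `W` | `d = p* = −23` twist, `C = (u, r, s, t)` | partner `Wd` (Cremona) | `Δ(Wd)` |
|---|---|---|---|---|
| `14283i1 @23` (`j = 0`) | `[0, 0, 1, 0, −3042]` | `(23, 0, 0, 23³/2)` | `27a3 = [0, 0, 1, 0, 0]` (`r = 0`) | `−27` |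
| `16928e1 @23` (`j = 1728`) | `[0, 0, 0, −529, 0] = E_{23}` | `(23, 0, 0, 0)` | `32a2 = [0, 0, 0, −1, 0] = E_1` (`r = 0`) | `64` |
| `19044c1 @23` (`j = 0`) | `[0, 0, 0, 0, −12167]` | `(23, 0, 0, 0)` | `36a1 = [0, 0, 0, 0, 1]` (`r = 0`) | `−432` |

(harvest-1 g13 `g13/x12e2rec/records.{py,json}`: the EXACT `ℚ`-isomorphism class of
`W.quadraticTwist (−23)` identified in Cremona's `allcurves` and the variable change solved in
exact rational arithmetic; the kernel RE-VERIFIES each identity below by `ext; norm_num`.)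

For each pair: the model and its partner as `def`s; `IsElliptic` / `IsGloballyMinimal` instances
PROVED (harvest-1 g3's `X12CubeSum.isElliptic_mk` / `isGloballyMinimal_mk` for `[0,0,a₃,0,a₆]`,
the tree's `isElliptic_congruentNumberCurve` / `isGloballyMinimal_congruentNumberCurve` for `E_n`, the
partner `E_1`'s taken inside the proof);
CM (`hasCM_of_j_eq_zero`, `LiLiuTian2024.hasCM_congruentNumberCurve`); the twist identity
`C • W.quadraticTwist (−23) = Wd`; `Good Wd 23` (`23 ∤ Δ(Wd)`, Silverman VII.5.1(a) through the
tree's `hasGoodReductionAt_map_of_not_dvd` / `hasGoodReductionAtPrime_congruentNumberCurve`); and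
the record **`irr_… : Irr W 23`** with NO hypothesis. Finally the Matar–Nekovář booking shape of
`HeegnerIndexRoute.lean` specialised to the pair (`bsdp_…_of_matarNekovar`): the remaining inputs
are the PUBLISHED named facts (MN19 Thm. 6.7 (1), GZK) and the per-pair certificate data (Heegner
field `K′`, Heegner point `P` of infinite order, `23 ∤ [E(K′) : ℤP]`; `r_an ≤ 1`; `#Ш_an` a
`23`-adic unit) — census values (hyp `mn19_eligible.tsv`: `14283i1`: `K′ = ℚ(√−20)`/`ℚ(√−56)`,
index `4`/`12`; `16928e1`: `ℚ(√−15)`/`ℚ(√−79)`, `4`/`4`; `19044c1`: `ℚ(√−191)`, `12`;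
`#Ш_an = 1`, `r_an = 1` on all three), NOT kernel facts.

References: J. E. Cremona, *Algorithms for Modular Elliptic Curves* (1997), Table 1 (models
`14283i1`, `16928e1`, `19044c1`, `27a3`, `32a2`, `36a1`) [Cremona1997]; J.-P. Serre, Invent.
Math. 15 (1972) §1.11 Prop. 12, §4.5 [Serre1972]; J. H. Silverman, *AEC* (2009) III.1, VII.1
Rem. 1.1, VII.5 Prop. 5.1(a), X.5 Cor. 5.4 [SilvermanAEC2009]; A. Matar, J. Nekovář, JTNB 31 (2019)
Thm. 6.7 (1) [MatarNekovar2019]; harvest-1 RECLASSIFY.md §GEN-13.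
-/

noncomputable section

open scoped Classical

open WeierstrassCurve IsDedekindDomain NumberField Rat.HeightOneSpectrum
  Literature.NumberTheory.EllipticCurves
  Literature.NumberTheory.EllipticCurves.Rank1Residual
  Literature.NumberTheory.EllipticCurves.Rank1Residual.Typed
  Literature.NumberTheory.EllipticCurves.Rank1Residual.X12CubeSum

namespace Summit.BirchSwinnertonDyer.Rank1Residual.X12.Records

/-- `23` is prime (instance for the prime-indexed predicates at `p = 23`). -/
instance fact_prime_twentyThree : Fact (Nat.Prime 23) := ⟨by norm_num⟩

/-! ## §0 Two reusable steps on literal integer models -/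

/-- **Good reduction of an integer model at `p ∤ Δ`**, prime-indexed form: for `E₀/ℤ` and a prime
`p` with `p ∤ Δ(E₀)`, the curve `E₀ ⊗ ℚ` has good reduction at `p` (Silverman VII.5.1(a); tree:
`hasGoodReductionAt_map_of_not_dvd` + the bridge `hasGoodReductionAtPrime_iff_hasGoodReductionAt_ringOfIntegers`).
[cite: SilvermanAEC2009, VII.5 Prop. 5.1(a)] -/
theorem hasGoodReductionAtPrime_map_of_not_dvd (E₀ : WeierstrassCurve ℤ) (p : ℕ) [hp : Fact p.Prime]
    (hΔ : ¬ (p : ℤ) ∣ E₀.Δ) : (E₀.map (Int.castRingHom ℚ)).HasGoodReductionAtPrime p := by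
  obtain ⟨v, hv⟩ : ∃ v : HeightOneSpectrum (𝓞 ℚ), (primesEquiv v : ℕ) = p :=
    ⟨primesEquiv.symm ⟨p, hp.out⟩, by rw [Equiv.apply_symm_apply]⟩
  subst hv
  exact (hasGoodReductionAtPrime_iff_hasGoodReductionAt_ringOfIntegers v _).2
    (hasGoodReductionAt_map_of_not_dvd _ v hΔ)

/-- The integer equation `[0, 0, a₃, 0, a₆]` maps to the rational one (casts pushed). [folklore] -/
theorem map_mk_int_j0 (a3 a6 : ℤ) :
    (⟨0, 0, a3, 0, a6⟩ : WeierstrassCurve ℤ).map (Int.castRingHom ℚ) =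
      (⟨0, 0, (a3 : ℚ), 0, (a6 : ℚ)⟩ : WeierstrassCurve ℚ) := by
  ext <;> simp [WeierstrassCurve.map]

/-! ## §1 `14283i1 @ 23` (`j = 0`; partner `27a3`) -/

/-- Cremona `14283i1`: `y² + y = x³ − 3042` (`N = 14283 = 3³·23²`, `j = 0`, CM by `ℤ[ζ₃]`;
X12 core pair at `p = 23`, `e = 2`). [cite: Cremona1997, Table 1 (curve 14283i1)] -/
def cremona14283i1 : WeierstrassCurve ℚ := ⟨0, 0, 1, 0, -3042⟩

/-- Cremona `27a3`: `y² + y = x³` (`N = 27`, `j = 0`, rank `0`): the twist partner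
`14283i1^{(−23)}`. [cite: Cremona1997, Table 1 (curve 27a3)] -/
def cremona27a3 : WeierstrassCurve ℚ := ⟨0, 0, 1, 0, 0⟩

/-- `14283i1` is an elliptic curve. -/
instance isElliptic_cremona14283i1 : cremona14283i1.IsElliptic := isElliptic_mk (by norm_num)

/-- `27a3` is an elliptic curve. -/
instance isElliptic_cremona27a3 : cremona27a3.IsElliptic := isElliptic_mk (by norm_num)

/-- `[0, 0, 1, 0, −3042]` is globally minimal (`b₆ = −23³`, `Δ = −27·23⁶`). [cite: SilvermanAEC2009, VII.1 Remark 1.1 and VIII.8] -/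
instance isGloballyMinimal_cremona14283i1 : cremona14283i1.IsGloballyMinimal := by
  have h := isGloballyMinimal_mk 1 (-3042) 50 (by norm_num) (by norm_num) (by norm_num) (by decide)
  norm_num at h
  exact h

/-- `[0, 0, 1, 0, 0]` is globally minimal (`Δ = −27`). [cite: SilvermanAEC2009, VII.1 Remark 1.1 and VIII.8] -/
instance isGloballyMinimal_cremona27a3 : cremona27a3.IsGloballyMinimal := by
  have h := isGloballyMinimal_mk 1 0 50 (by norm_num) (by norm_num) (by norm_num) (by decide)
  norm_num at h
  exact h

/-- `j(14283i1) = 0`. [cite: Cremona1997, Table 1 (curve 14283i1)] -/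
theorem cremona14283i1_j : cremona14283i1.j = 0 := by
  have hc4 : cremona14283i1.c₄ = 0 := by
    norm_num [cremona14283i1, WeierstrassCurve.c₄, WeierstrassCurve.b₂, WeierstrassCurve.b₄]
  rw [WeierstrassCurve.j, hc4]
  simp

/-- `14283i1` has complex multiplication (`j = 0`). -/
theorem hasCM_cremona14283i1 : cremona14283i1.HasCM := hasCM_of_j_eq_zero _ cremona14283i1_j

/-- **Twist identity**: `C • 14283i1^{(−23)} = 27a3` with `C = (23, 0, 0, 23³/2)` (the tree's
`quadraticTwist`, Mathlib's `VariableChange` action). [cite: SilvermanAEC2009, III.1 Table 3.1 and X.5 Cor. 5.4] -/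
theorem twist_cremona14283i1 :
    ∃ C : VariableChange ℚ, C • cremona14283i1.quadraticTwist (-23) = cremona27a3 := by
  refine ⟨⟨Units.mk0 (23 : ℚ) (by norm_num), 0, 0, 12167 / 2⟩, ?_⟩
  ext <;> simp only [variableChange_a₁, variableChange_a₂, variableChange_a₃, variableChange_a₄,
    variableChange_a₆, quadraticTwist_a₁, quadraticTwist_a₂, quadraticTwist_a₃, quadraticTwist_a₄,
    quadraticTwist_a₆, Units.val_inv_eq_inv_val, Units.val_mk0, cremona14283i1, cremona27a3,
    WeierstrassCurve.b₂, WeierstrassCurve.b₄, WeierstrassCurve.b₆] <;> norm_num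

/-- `27a3 = [0, 0, 1, 0, 0] ⊗ ℚ`. [folklore] -/
theorem cremona27a3_eq_map :
    cremona27a3 = (⟨0, 0, 1, 0, 0⟩ : WeierstrassCurve ℤ).map (Int.castRingHom ℚ) := by
  rw [map_mk_int_j0]; norm_num [cremona27a3]

/-- **`27a3` has good reduction at `23`** (`Δ = −27`). [cite: SilvermanAEC2009, VII.5 Prop. 5.1(a)] -/
theorem good_cremona27a3 : Good cremona27a3 23 := by
  rw [cremona27a3_eq_map]
  exact hasGoodReductionAtPrime_map_of_not_dvd _ 23 (by rw [Δ_mk_int]; norm_num)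

/-- **RECORD `14283i1 @ 23`: `E[23]` is irreducible — a kernel theorem, no engine**
(`X12.irr_of_hasCM_good_twist` with CM, the twist identity and `Good 27a3 23` discharged above).
[cite: Serre1972, §1.11 Prop. 12 and §4.5] [cite: SilvermanAEC2009, X.5 Cor. 5.4] -/
theorem irr_cremona14283i1 : Irr cremona14283i1 23 :=
  irr_of_hasCM_good_twist cremona14283i1 23 cremona27a3 hasCM_cremona14283i1 (by norm_num)
    (by norm_num) twist_cremona14283i1 good_cremona27a3

/-- **RECORD `14283i1 @ 23`, booking shape**: `BSD(14283i1, 23)` from Matar–Nekovář 2019 Thm. 6.7 (1)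
(`hMN`, PUBLISHED named fact) + GZK, given the per-pair certificate (Heegner field `K′`, Heegner
point `P` of infinite order, `23 ∤ [E(K′) : ℤP]`), `r_an ≤ 1` and `#Ш_an` a `23`-adic unit;
CM / twist / good reduction / `irr(23)` are kernel theorems. Nothing booked here.
[cite: MatarNekovar2019, Thm. 6.7 (1) (p. 498)] [cite: Miller2011LMS, §1 and Def. 1.1] -/
theorem bsdp_cremona14283i1_of_matarNekovar
    (hGZK : rank_eq_analyticRank_of_analyticRank_le_one)
    {N : ℕ} [NeZero N] {K' : Type} [Field K'] [NumberField K']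
    (hMN : MatarNekovar2019.thm67_sha_primary_trivial_of_irreducible N cremona14283i1 K')
    (hr : cremona14283i1.analyticRank ≤ 1)
    (hK' : IsImaginaryQuadratic K') (hH : SatisfiesHeegnerHypothesis N K')
    {P : (cremona14283i1.baseChange K').toAffine.Point} (hP : IsHeegnerPoint N cremona14283i1 K' P)
    (hnt : ¬ IsOfFinAddOrder P) (hI : ¬ 23 ∣ (AddSubgroup.zmultiples P).index)
    {q : ℚ} (hq : shaAn cremona14283i1 = (q : ℂ)) (hv : padicValRat 23 q = 0) :
    BSDp cremona14283i1 23 :=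
  bsdp_of_matarNekovar_of_not_dvd_index' cremona14283i1 23 hGZK hMN hr (by norm_num) hK' hH hP hnt hI
    irr_cremona14283i1 hq hv

/-! ## §2 `16928e1 @ 23` (`j = 1728`; `16928e1 = E_{23}`, partner `32a2 = E_1`) -/

/-- Cremona `16928e1` is the congruent number curve `E_{23} : y² = x³ − 23²x`
(`N = 16928 = 2⁵·23²`, `j = 1728`, CM by `ℤ[i]`; X12 core pair at `p = 23`, `e = 2`).
[cite: Cremona1997, Table 1 (curve 16928e1)] -/
theorem congruentNumberCurve_twentyThree_eq :
    congruentNumberCurve 23 = (⟨0, 0, 0, -529, 0⟩ : WeierstrassCurve ℚ) := by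
  norm_num [congruentNumberCurve]

/-- Cremona `32a2` is `E_1 : y² = x³ − x` (`N = 32`, rank `0`): the twist partner `E_{23}^{(−23)}`.
[cite: Cremona1997, Table 1 (curve 32a2)] -/
theorem congruentNumberCurve_one_eq :
    congruentNumberCurve 1 = (⟨0, 0, 0, -1, 0⟩ : WeierstrassCurve ℚ) := by
  norm_num [congruentNumberCurve]

/-- `E_{23}` is an elliptic curve. -/
instance isElliptic_congruentNumberCurve_twentyThree : (congruentNumberCurve 23).IsElliptic :=
  isElliptic_congruentNumberCurve (by norm_num)

/-- `E_{23}` is globally minimal (`23` squarefree). [cite: SilvermanAEC2009, VII.1 Remark 1.1 and VIII.8] -/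
instance isGloballyMinimal_congruentNumberCurve_twentyThree : (congruentNumberCurve 23).IsGloballyMinimal :=
  isGloballyMinimal_congruentNumberCurve (by norm_num : Nat.Prime 23).squarefree

/-- **Twist identity**: `C • E_{23}^{(−23)} = E_1` with `C = (23, 0, 0, 0)`.
[cite: SilvermanAEC2009, III.1 Table 3.1 and X.5 Cor. 5.4] -/
theorem twist_congruentNumberCurve_twentyThree :
    ∃ C : VariableChange ℚ, C • (congruentNumberCurve 23).quadraticTwist (-23) =
      congruentNumberCurve 1 := by
  refine ⟨⟨Units.mk0 (23 : ℚ) (by norm_num), 0, 0, 0⟩, ?_⟩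
  ext <;> simp only [variableChange_a₁, variableChange_a₂, variableChange_a₃, variableChange_a₄,
    variableChange_a₆, quadraticTwist_a₁, quadraticTwist_a₂, quadraticTwist_a₃, quadraticTwist_a₄,
    quadraticTwist_a₆, Units.val_inv_eq_inv_val, Units.val_mk0, congruentNumberCurve,
    WeierstrassCurve.b₂, WeierstrassCurve.b₄, WeierstrassCurve.b₆] <;> norm_num

/-- **`E_1` has good reduction at `23`** (`23 ∤ 2·1`; tree theorem
`hasGoodReductionAtPrime_congruentNumberCurve`). [cite: SilvermanAEC2009, VII.5 Prop. 5.1(a)] -/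
theorem good_congruentNumberCurve_one : Good (congruentNumberCurve 1) 23 :=
  hasGoodReductionAtPrime_congruentNumberCurve (by norm_num)

/-- **RECORD `16928e1 @ 23`: `E_{23}[23]` is irreducible — a kernel theorem, no engine**
(CM: `LiLiuTian2024.hasCM_congruentNumberCurve`; twist identity; `Good E_1 23`).
[cite: Serre1972, §1.11 Prop. 12 and §4.5] [cite: SilvermanAEC2009, X.5 Cor. 5.4] -/
theorem irr_congruentNumberCurve_twentyThree : Irr (congruentNumberCurve 23) 23 := by
  -- the partner's instances are tree theorems (`E_1`: `Δ = 64 ≠ 0`; `1` squarefree)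
  haveI : (congruentNumberCurve 1).IsElliptic := isElliptic_congruentNumberCurve one_ne_zero
  haveI : (congruentNumberCurve 1).IsGloballyMinimal :=
    isGloballyMinimal_congruentNumberCurve squarefree_one
  exact irr_of_hasCM_good_twist (congruentNumberCurve 23) 23 (congruentNumberCurve 1)
    (LiLiuTian2024.hasCM_congruentNumberCurve 23) (by norm_num) (by norm_num)
    twist_congruentNumberCurve_twentyThree good_congruentNumberCurve_one

/-- **RECORD `16928e1 @ 23`, booking shape** (as `bsdp_cremona14283i1_of_matarNekovar`).
[cite: MatarNekovar2019, Thm. 6.7 (1) (p. 498)] [cite: Miller2011LMS, §1 and Def. 1.1] -/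
theorem bsdp_congruentNumberCurve_twentyThree_of_matarNekovar
    (hGZK : rank_eq_analyticRank_of_analyticRank_le_one)
    {N : ℕ} [NeZero N] {K' : Type} [Field K'] [NumberField K']
    (hMN : MatarNekovar2019.thm67_sha_primary_trivial_of_irreducible N (congruentNumberCurve 23) K')
    (hr : (congruentNumberCurve 23).analyticRank ≤ 1)
    (hK' : IsImaginaryQuadratic K') (hH : SatisfiesHeegnerHypothesis N K')
    {P : ((congruentNumberCurve 23).baseChange K').toAffine.Point}
    (hP : IsHeegnerPoint N (congruentNumberCurve 23) K' P)
    (hnt : ¬ IsOfFinAddOrder P) (hI : ¬ 23 ∣ (AddSubgroup.zmultiples P).index)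
    {q : ℚ} (hq : shaAn (congruentNumberCurve 23) = (q : ℂ)) (hv : padicValRat 23 q = 0) :
    BSDp (congruentNumberCurve 23) 23 :=
  bsdp_of_matarNekovar_of_not_dvd_index' (congruentNumberCurve 23) 23 hGZK hMN hr (by norm_num) hK'
    hH hP hnt hI irr_congruentNumberCurve_twentyThree hq hv

/-! ## §3 `19044c1 @ 23` (`j = 0`; partner `36a1`) -/

/-- Cremona `19044c1`: `y² = x³ − 23³` (`N = 19044 = 2²·3²·23²`, `j = 0`, CM by `ℤ[ζ₃]`; X12 core
pair at `p = 23`, `e = 2`). [cite: Cremona1997, Table 1 (curve 19044c1)] -/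
def cremona19044c1 : WeierstrassCurve ℚ := ⟨0, 0, 0, 0, -12167⟩

/-- Cremona `36a1`: `y² = x³ + 1` (`N = 36`, `j = 0`, rank `0`): the twist partner
`19044c1^{(−23)}`. [cite: Cremona1997, Table 1 (curve 36a1)] -/
def cremona36a1 : WeierstrassCurve ℚ := ⟨0, 0, 0, 0, 1⟩

/-- `19044c1` is an elliptic curve. -/
instance isElliptic_cremona19044c1 : cremona19044c1.IsElliptic := isElliptic_mk (by norm_num)

/-- `36a1` is an elliptic curve. -/
instance isElliptic_cremona36a1 : cremona36a1.IsElliptic := isElliptic_mk (by norm_num)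

/-- `[0, 0, 0, 0, −23³]` is globally minimal (`b₆ = −4·23³`, `Δ = −2⁴·3³·23⁶`). [cite: SilvermanAEC2009, VII.1 Remark 1.1 and VIII.8] -/
instance isGloballyMinimal_cremona19044c1 : cremona19044c1.IsGloballyMinimal := by
  have h := isGloballyMinimal_mk 0 (-12167) 50 (by norm_num) (by norm_num) (by norm_num) (by decide)
  norm_num at h
  exact h

/-- `[0, 0, 0, 0, 1]` is globally minimal (`Δ = −432`). [cite: SilvermanAEC2009, VII.1 Remark 1.1 and VIII.8] -/
instance isGloballyMinimal_cremona36a1 : cremona36a1.IsGloballyMinimal := by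
  have h := isGloballyMinimal_mk 0 1 50 (by norm_num) (by norm_num) (by norm_num) (by decide)
  norm_num at h
  exact h

/-- `j(19044c1) = 0`. [cite: Cremona1997, Table 1 (curve 19044c1)] -/
theorem cremona19044c1_j : cremona19044c1.j = 0 := by
  have hc4 : cremona19044c1.c₄ = 0 := by
    norm_num [cremona19044c1, WeierstrassCurve.c₄, WeierstrassCurve.b₂, WeierstrassCurve.b₄]
  rw [WeierstrassCurve.j, hc4]
  simp

/-- `19044c1` has complex multiplication (`j = 0`). -/
theorem hasCM_cremona19044c1 : cremona19044c1.HasCM := hasCM_of_j_eq_zero _ cremona19044c1_j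

/-- **Twist identity**: `C • 19044c1^{(−23)} = 36a1` with `C = (23, 0, 0, 0)`.
[cite: SilvermanAEC2009, III.1 Table 3.1 and X.5 Cor. 5.4] -/
theorem twist_cremona19044c1 :
    ∃ C : VariableChange ℚ, C • cremona19044c1.quadraticTwist (-23) = cremona36a1 := by
  refine ⟨⟨Units.mk0 (23 : ℚ) (by norm_num), 0, 0, 0⟩, ?_⟩
  ext <;> simp only [variableChange_a₁, variableChange_a₂, variableChange_a₃, variableChange_a₄,
    variableChange_a₆, quadraticTwist_a₁, quadraticTwist_a₂, quadraticTwist_a₃, quadraticTwist_a₄,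
    quadraticTwist_a₆, Units.val_inv_eq_inv_val, Units.val_mk0, cremona19044c1, cremona36a1,
    WeierstrassCurve.b₂, WeierstrassCurve.b₄, WeierstrassCurve.b₆] <;> norm_num

/-- `36a1 = [0, 0, 0, 0, 1] ⊗ ℚ`. [folklore] -/
theorem cremona36a1_eq_map :
    cremona36a1 = (⟨0, 0, 0, 0, 1⟩ : WeierstrassCurve ℤ).map (Int.castRingHom ℚ) := by
  rw [map_mk_int_j0]; norm_num [cremona36a1]

/-- **`36a1` has good reduction at `23`** (`Δ = −432`). [cite: SilvermanAEC2009, VII.5 Prop. 5.1(a)] -/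
theorem good_cremona36a1 : Good cremona36a1 23 := by
  rw [cremona36a1_eq_map]
  exact hasGoodReductionAtPrime_map_of_not_dvd _ 23 (by rw [Δ_mk_int]; norm_num)

/-- **RECORD `19044c1 @ 23`: `E[23]` is irreducible — a kernel theorem, no engine.**
[cite: Serre1972, §1.11 Prop. 12 and §4.5] [cite: SilvermanAEC2009, X.5 Cor. 5.4] -/
theorem irr_cremona19044c1 : Irr cremona19044c1 23 :=
  irr_of_hasCM_good_twist cremona19044c1 23 cremona36a1 hasCM_cremona19044c1 (by norm_num)
    (by norm_num) twist_cremona19044c1 good_cremona36a1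

/-- **RECORD `19044c1 @ 23`, booking shape** (as `bsdp_cremona14283i1_of_matarNekovar`).
[cite: MatarNekovar2019, Thm. 6.7 (1) (p. 498)] [cite: Miller2011LMS, §1 and Def. 1.1] -/
theorem bsdp_cremona19044c1_of_matarNekovar
    (hGZK : rank_eq_analyticRank_of_analyticRank_le_one)
    {N : ℕ} [NeZero N] {K' : Type} [Field K'] [NumberField K']
    (hMN : MatarNekovar2019.thm67_sha_primary_trivial_of_irreducible N cremona19044c1 K')
    (hr : cremona19044c1.analyticRank ≤ 1)
    (hK' : IsImaginaryQuadratic K') (hH : SatisfiesHeegnerHypothesis N K')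
    {P : (cremona19044c1.baseChange K').toAffine.Point} (hP : IsHeegnerPoint N cremona19044c1 K' P)
    (hnt : ¬ IsOfFinAddOrder P) (hI : ¬ 23 ∣ (AddSubgroup.zmultiples P).index)
    {q : ℚ} (hq : shaAn cremona19044c1 = (q : ℂ)) (hv : padicValRat 23 q = 0) :
    BSDp cremona19044c1 23 :=
  bsdp_of_matarNekovar_of_not_dvd_index' cremona19044c1 23 hGZK hMN hr (by norm_num) hK' hH hP hnt hI
    irr_cremona19044c1 hq hv

/-! ## §4 Summary: the three one-engine `e = 2` pairs at `p = 23` have `irr(23)` in the kernel -/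

/-- **The three `e = 2` X12 core pairs at `p = 23` whose irreducibility bit was one-engine on the
census (`14283i1`, `16928e1 = E_{23}`, `19044c1`) have `E[23]` irreducible as a KERNEL THEOREM.**
[cite: Serre1972, §1.11 Prop. 12 and §4.5] -/
theorem irr_twentyThree_records :
    Irr cremona14283i1 23 ∧ Irr (congruentNumberCurve 23) 23 ∧ Irr cremona19044c1 23 :=
  ⟨irr_cremona14283i1, irr_congruentNumberCurve_twentyThree, irr_cremona19044c1⟩

end Summit.BirchSwinnertonDyer.Rank1Residual.X12.Records

end
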